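import Mathlib
import HarnessLib
import Literature.MathematicalPhysics.QuantumLattice.KohnLuttinger
import Literature.MathematicalPhysics.QuantumLattice.KohnLuttingerChannelStates
import Literature.MathematicalPhysics.QuantumLattice.KohnLuttingerLindhardMeasurable
import Summits.HubbardSuperconductivity.HubbardSuperconductivity.Theorems.WeakCouplingBCSWcbcsKohnLuttingerB1gReduction
import Summits.HubbardSuperconductivity.HubbardSuperconductivity.Theorems.WeakCouplingBCSKlCertTPrimePHReflection
import Summits.HubbardSuperconductivity.HubbardSuperconductivity.Theorems.ChiralWindowCwKLChiralWindowD4Invariant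
import Summits.HubbardSuperconductivity.HubbardSuperconductivity.Theorems.WeakCouplingBCSKlSublatticeFermiMeasure

/-!
# The sublattice cover and the point group: twisted channels («(KLSCAN)-SUBLATTICE-DUALITY-DISCHARGE» part 5;
# cell gate-hubbard-kl, seat p4 g20)

The folded sublattice cover `Φ = fold ∘ A` (`klslCover`) intertwines the point group `D₄` of the square lattice with itself up to
the OUTER automorphism `rᵢ ↦ r₋ᵢ`, `s rᵢ ↦ s r₃₋ᵢ`, which on the irreducible characters is `τ : B1g ↔ B2g` (`klslTau`; `A1g, A2g, E`
fixed) — `d_{x²-y²}` gap functions of the pure-`t` band pull back to `d_{xy}` gap functions of the pure-`t'` band.  Exactly: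

* `klslGood` — momenta off the four lines `k₀ ± k₁ = ±π` (where a coordinate of `A k` is `±π` and the fold is not odd);
  measurable, `D₄`-invariant (`d4Momentum_mem_klslGood_iff`);
* `klslCover_rotMomentum` (on the good set `Φ (r k) = r³ (Φ k)`), `klslCover_reflMomentum` (`Φ (s k) = s r³ (Φ k)`, everywhere);
* **`klsl_d4Project_cover`**: `P_{τχ}(𝟙_G · (ψ ∘ Φ))(k) = (P_χ ψ)(Φ k)` for `k ∈ G`, and
  **`klsl_inChannel_cover`**: `ψ ∈ χ ⇒ 𝟙_G · (ψ ∘ Φ) ∈ τχ` pointwise on all of momentum space.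

Honest framing: finite group bookkeeping; nothing asserts a margin, the window, `K₃` or superconductivity.
-/

noncomputable section

set_option linter.dupNamespace false

namespace Summit.HubbardSuperconductivity.HubbardSuperconductivity.Theorems

open MeasureTheory Real Set Literature.MathematicalPhysics.QuantumLattice
open scoped ENNReal Pointwise

/-! ### §10 The twisted channel labels and the good set of the cover -/

/-- The outer automorphism of `D₄` on its irreducible characters: `B1g ↔ B2g`, the others fixed (`d_{x²-y²} ↔ d_{xy}`
under the 45° sublattice rotation). [folklore] -/
def klslTau : D4Irrep → D4Irrep
  | .B1g => .B2g
  | .B2g => .B1g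
  | .A1g => .A1g
  | .A2g => .A2g
  | .E => .E

/-- `τ` is an involution. [folklore] -/
@[simp] theorem klslTau_klslTau (χ : D4Irrep) : klslTau (klslTau χ) = χ := by cases χ <;> rfl

/-- The **good set** of the cover: momenta off the four lines `k₀ ± k₁ = ±π` (there `A k` has no coordinate `±π`, so the
fold commutes with the point group). It is `D₄`-invariant and contains every Fermi curve of `ε'` at a negative level. [folklore] -/
def klslGood : Set Momentum := {k | |k 0 + k 1| ≠ π ∧ |k 0 - k 1| ≠ π}

/-- The good set is measurable. [folklore] -/
theorem klsl_measurableSet_good : MeasurableSet klslGood :=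
  ((klsl_measurable_fst.add klsl_measurable_snd).abs (measurableSet_singleton π)).compl.inter
    ((klsl_measurable_fst.sub klsl_measurable_snd).abs (measurableSet_singleton π)).compl

/-- The good set is invariant under the quarter turn. [folklore] -/
theorem rotMomentum_mem_klslGood_iff (k : Momentum) : rotMomentum k ∈ klslGood ↔ k ∈ klslGood := by
  simp only [klslGood, mem_setOf_eq, rotMomentum_apply_zero, rotMomentum_apply_one]
  rw [show -k 1 + k 0 = k 0 - k 1 by ring, show -k 1 - k 0 = -(k 0 + k 1) by ring, abs_neg]
  exact and_comm

/-- The good set is invariant under the reflection. [folklore] -/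
theorem reflMomentum_mem_klslGood_iff (k : Momentum) : reflMomentum k ∈ klslGood ↔ k ∈ klslGood := by
  simp only [klslGood, mem_setOf_eq, reflMomentum_apply_zero, reflMomentum_apply_one]
  rw [show k 0 + -k 1 = k 0 - k 1 by ring, show k 0 - -k 1 = k 0 + k 1 by ring]
  exact and_comm

/-- The good set is `D₄`-invariant. [folklore] -/
theorem d4Momentum_mem_klslGood_iff (γ : DihedralGroup 4) (k : Momentum) :
    d4Momentum γ k ∈ klslGood ↔ k ∈ klslGood := by
  rcases kl_sp_d4_cases γ with rfl | rfl | rfl | rfl | rfl | rfl | rfl | rfl <;>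
    simp only [d4Momentum_r_zero, d4Momentum_r_one, d4Momentum_r_two, d4Momentum_r_three,
      d4Momentum_sr_zero, d4Momentum_sr_one, d4Momentum_sr_two, d4Momentum_sr_three,
      rotMomentum_mem_klslGood_iff, reflMomentum_mem_klslGood_iff]

/-- Off `±π` the fold is odd. [folklore] -/
theorem klslWrap_neg {x : ℝ} (hx : |x| ≠ π) : klslWrap (-x) = -klslWrap x := by
  have h1 : x ≠ π := fun h => hx (by rw [h, abs_of_pos pi_pos])
  have h2 : x ≠ -π := fun h => hx (by rw [h, abs_neg, abs_of_pos pi_pos])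
  unfold klslWrap
  by_cases ha : x < -π
  · have hb : ¬ -x < -π := by linarith [pi_pos]
    have hc : ¬ -x < π := by linarith
    simp only [ha, hb, hc, if_true, if_false]; ring
  by_cases hb : x < π
  · have ha' : -π < x := lt_of_le_of_ne (not_lt.1 ha) (Ne.symm h2)
    have hc : ¬ -x < -π := by linarith
    have hd : -x < π := by linarith
    simp only [ha, hb, hc, hd, if_true, if_false]
  · have hb' : π < x := lt_of_le_of_ne (not_lt.1 hb) (Ne.symm h1)
    have hc : -x < -π := by linarith
    simp only [ha, hb, hc, if_true, if_false]; ring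

/-- **On the good set the cover intertwines the quarter turn with its inverse**: `Φ (r k) = r³ (Φ k)`. [folklore] -/
theorem klslCover_rotMomentum {k : Momentum} (hk : k ∈ klslGood) :
    klslCover (rotMomentum k) = rotMomentum (rotMomentum (rotMomentum (klslCover k))) := by
  ext i; fin_cases i
  · simp [klslCover]; ring_nf
  · simp [klslCover]
    rw [show -k 1 - k 0 = -(k 0 + k 1) by ring, klslWrap_neg hk.1]

/-- **The cover intertwines the reflection with the diagonal reflection**: `Φ (s k) = s r³ (Φ k)` (no condition). [folklore] -/
theorem klslCover_reflMomentum (k : Momentum) :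
    klslCover (reflMomentum k) = reflMomentum (rotMomentum (rotMomentum (rotMomentum (klslCover k)))) := by
  ext i; fin_cases i
  · simp [klslCover]; ring_nf
  · simp [klslCover]

/-- **Intertwining of the isotypic projections along the cover**: on the good set,
`P_{τχ} (𝟙_G · (ψ ∘ Φ)) (k) = (P_χ ψ) (Φ k)` — the eight terms match under `rᵢ ↦ r₋ᵢ`, `s rᵢ ↦ s r₃₋ᵢ`. [folklore] -/
theorem klsl_d4Project_cover (χ : D4Irrep) (ψ : Momentum → ℝ) {k : Momentum} (hk : k ∈ klslGood) :
    d4Project (klslTau χ) (klslGood.indicator (ψ ∘ klslCover)) k = d4Project χ ψ (klslCover k) := by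
  have hg : ∀ {q : Momentum}, q ∈ klslGood → rotMomentum q ∈ klslGood := fun h => (rotMomentum_mem_klslGood_iff _).2 h
  have hs : ∀ {q : Momentum}, q ∈ klslGood → reflMomentum q ∈ klslGood := fun h => (reflMomentum_mem_klslGood_iff _).2 h
  have hk1 := hg hk
  have hk2 := hg hk1
  have hk3 := hg hk2
  set u := klslCover k with hu
  have e1 : klslCover (rotMomentum k) = rotMomentum (rotMomentum (rotMomentum u)) := klslCover_rotMomentum hk
  have e2 : klslCover (rotMomentum (rotMomentum k)) = rotMomentum (rotMomentum u) := by
    rw [klslCover_rotMomentum hk1, e1, kl_d4_rot_rot_rot_rot]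
  have e3 : klslCover (rotMomentum (rotMomentum (rotMomentum k))) = rotMomentum u := by
    rw [klslCover_rotMomentum hk2, e2, kl_d4_rot_rot_rot_rot]
  have f0 : klslCover (reflMomentum k) = reflMomentum (rotMomentum (rotMomentum (rotMomentum u))) := klslCover_reflMomentum k
  have f1 : klslCover (reflMomentum (rotMomentum k)) = reflMomentum (rotMomentum (rotMomentum u)) := by
    rw [klslCover_reflMomentum, e1, kl_d4_rot_rot_rot_rot]
  have f2 : klslCover (reflMomentum (rotMomentum (rotMomentum k))) = reflMomentum (rotMomentum u) := by
    rw [klslCover_reflMomentum, e2, kl_d4_rot_rot_rot_rot]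
  have f3 : klslCover (reflMomentum (rotMomentum (rotMomentum (rotMomentum k)))) = reflMomentum u := by
    rw [klslCover_reflMomentum, e3, kl_d4_rot_rot_rot_rot]
  have ne10 : (1 : ZMod 4) ≠ 0 := by decide
  have ne12 : (1 : ZMod 4) ≠ 2 := by decide
  have ne20 : (2 : ZMod 4) ≠ 0 := by decide
  have ne30 : (3 : ZMod 4) ≠ 0 := by decide
  have ne32 : (3 : ZMod 4) ≠ 2 := by decide
  simp only [d4Project, sum_dihedralGroup_four, d4Momentum_r_zero, d4Momentum_r_one, d4Momentum_r_two,
    d4Momentum_r_three, d4Momentum_sr_zero, d4Momentum_sr_one, d4Momentum_sr_two, d4Momentum_sr_three,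
    Set.indicator_of_mem hk, Set.indicator_of_mem hk1, Set.indicator_of_mem hk2, Set.indicator_of_mem hk3,
    Set.indicator_of_mem (hs hk), Set.indicator_of_mem (hs hk1), Set.indicator_of_mem (hs hk2), Set.indicator_of_mem (hs hk3),
    Function.comp_apply, ← hu, e1, e2, e3, f0, f1, f2, f3]
  cases χ <;>
  · simp only [klslTau, D4Irrep.char, D4Irrep.dim, zmod_four_val.1, zmod_four_val.2.1, zmod_four_val.2.2.1,
      zmod_four_val.2.2.2, ne10, ne12, ne20, ne30, ne32, if_true, if_false]
    norm_num
    try ring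

/-- **The cover transports channels along `τ`**: `ψ ∈ χ ⇒ 𝟙_G · (ψ ∘ Φ) ∈ τχ`, exactly and pointwise (off the good set both
sides vanish, since `G` is `D₄`-invariant). [cite: RaghuKivelsonScalapino2010, §III (17)] -/
theorem klsl_inChannel_cover {χ : D4Irrep} {ψ : Momentum → ℝ} (h : InChannel χ ψ) :
    InChannel (klslTau χ) (klslGood.indicator (ψ ∘ klslCover)) := by
  funext k
  by_cases hk : k ∈ klslGood
  · rw [klsl_d4Project_cover χ ψ hk, Set.indicator_of_mem hk, Function.comp_apply]
    exact congrFun h (klslCover k)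
  · simp only [d4Project, Set.indicator_of_notMem hk]
    rw [Finset.sum_eq_zero (fun γ _ => ?_), mul_zero]
    rw [Set.indicator_of_notMem (fun h' => hk ((d4Momentum_mem_klslGood_iff γ k).1 h')), mul_zero]

end Summit.HubbardSuperconductivity.HubbardSuperconductivity.Theorems

end
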